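/-
Copyright: the b2b-balaban T⁴-continuum CRUX team, row NE7b OWNER lineage `t4-ne7b-p1` (gen 135). Project licence.
-/
import Summits.QuantumFields.BalabanUV.T4Continuum.Spine.NE7b.SupFineCellActivityBound
import Summits.QuantumFields.BalabanUV.T4Continuum.Spine.NE7b.SupTwoLetterShift
import Summits.QuantumFields.BalabanUV.T4Continuum.Spine.NE7b.SupPolymerLocalExpansion

/-!
# THE FINE-CELL TWO-LETTER FORMAT MEETS THE POLYMER-LOCAL GAS — SHIFT, SET ACTIVITY LETTER, INTEGRABILITY: the three inputs that (353)'s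
# `gaussian_set_hypotheses` supplied from the one-rate regulated format are re-derived for the FINE-CELL TWO-LETTER format of SCOPING-d7:
#   (shift)  (S_fine) `‖g(ζ)‖ ≤ ε` when EVERY fine cell `c` of the big cell has `Σ_cζ² ≤ h²`, (L) `‖g(ζ)‖ ≤ M₀e^{½κ₀Σ_Pζ²}`; an external field with
#            `Σ_cψ² ≤ Ψ²` on the fine cells (`Ψ ≤ h`) and `Σ_Pψ² ≤ Ψ_P²` on the big cell ⟹ the pointwise bound consumed by (379),
#            `‖g(ω+ψ)‖ ≤ ε + 1{∃c: (h−Ψ)² < Σ_cω²}·M₀e^{½κ₀(1+τ⁻¹)Ψ_P²}·e^{½κ₀(1+τ)Σ_Pω²}`  — Minkowski per FINE cell, Young on the big cell at the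
#            SMALL rate: NO `e^{κΨ²}` with a large rate, NO inherited-rate condition;
#   (letter) families of cell SETS with singleton members fine-lettered (pointwise bound) and larger members sup-small `ε^{#X}`:
#            `|M(𝒜)| ≤ ∏_{X∈𝒜}ε_fine^{#X}`, `ε_fine = ε + m·M·e^{−½κ₂r²}·A₁^v·A₂^{v₀}` ((379) on the singleton members, re-indexed by their cells);
#   (int)    products of such factors are integrable (crude one-rate domination at the small rate).
# With the tree's finite-range independence and (355)'s join-measurability these are exactly the hypotheses of (357)'s `exp_setLogZ_linear` ∕
# `norm_setLogZ_le_linear` — the small-field half of the fine-cell closure (row NE7b, node U5c; (376)∕(379)∕(351) BY NAME; [folklore])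

Cell `pub-balaban`, sub-cell `t4`, spine estimate NE7b (`T4WeightBudget.RelWeightBound`; the cell's OWN estimate — NOT PRINTED in
[Bałaban 1983–89], NOT PROVED).  Crux-route work under `Spine/NE7b/` by the row OWNER (`t4-ne7b-p1` gen 135, file (380)) under FREEZE
(0)'s crux-prover clause, on this gen's SCOPING-d7 DECISION (1) (honest form); NOTHING of Bałaban's is named as a Lean object, valued or asserted;
no `T4Continuum/Support` leaf typed; no `def`, no notation; zero `sorry`.  Imports (BY NAME): the OWNER's (379) `…SupFineCellActivityBound`
(`norm_cellActivity_le_fineCell`), (376) `…SupTwoLetterShift` (`large_of_shift_large`; `sum_add_sq_le` through (292)),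
(353) `…SupPolymerLocalExpansion` (for the road's objects; `act_measurable_prod` through (287), `le_of_sets` through (348)), (288)
`integrable_exp_half_sq_on`, (289) `one_le_regulatorCost`; Mathlib's `integral_complex_ofReal`, `Finset.prod_image`, `Finset.singleton_biUnion`,
`Finset.prod_filter_mul_prod_filter_not`.

WHAT IS PROVED ([folklore]; `Q_A(ζ) := Σ_{x∈A}ζ_x²`, `ε_fine` displayed):
* §1 **`fineCell_shift`** (the displayed pointwise bound of the shifted factor);
* §2 `integral_prod_norm_le_fineCell` ((379) for the product of NORMS), `singletonFamily_eq_image` ∕ `prod_singletonFamily_eq` (singleton members ↔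
  their cells), `eps_fine_nonneg`, **`norm_setActivity_le_fineCell`** (the set activity letter `∏_{X∈𝒜}ε_fine^{#X}`);
* §3 `norm_prod_le_oneRate_crude` (pointwise domination `∏‖f_X‖ ≤ (ε+M)^{#𝒜₁}ε^{Σ_{𝒜₂}#X}e^{½κ₁Q_{cells 𝒜₁}}`), **`fineCell_integrable_prod`**;
  §4 toy.

HONEST (what this is NOT).  The small-field half's inputs; the closure statement (next factor normalised, its (L1⁺) by (377) verbatim and its
(S_fine⁺) on the per-fine-cell region, where the next fine family of a block is the union of the members' fine families — NESTING BY CONSTRUCTION)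
is the successor file; the local letter `γ₂` on sparse unions and the decay of the STABILITY RATE along the scales (it must fall like the inverse
field op-norm, which only the extraction of the quadratic part into the Gaussian provides — (α4)) remain; scalar skeleton ((A3), NC-NE7b-α
UNRULED); nothing of Bałaban's asserted.  BY-NAME EFFECT ON THE WALL: NONE.  NE7b NOT PRINTED ∕ NOT PROVED; spine PROVED 0∕9; rung (B)+1 — the
programme's measures remain FINITE-torus statements; NOT the mass gap, NOT Clay.  HONEST DEPENDENCY: continuum YM on T⁴ ⇐ BetaPertH ∧ nine spine
estimates (0∕9 proved); BetaPertH ⇐ (D1) ∧ (D4) ∧ CAP+tail; G-an2-4 gates asym, D1 and NE2∕3∕4.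
-/

set_option autoImplicit false

noncomputable section

namespace Summit.QuantumFields.BalabanUV.T4Continuum.NE7b.SupFineCellSetActivity

open MeasureTheory ProbabilityTheory Matrix Real Finset
open scoped BigOperators
open Literature.Probability.LatticeModels (cellActivity)
open SupFineCellActivityBound (norm_cellActivity_le_fineCell)
open SupTwoLetterShift (large_of_shift_large)
open SupRegulatedActivityShift (sum_add_sq_le)
open SupRegulatedActivityBound (one_le_regulatorCost)
open SupGaussianRegulator (integrable_exp_half_sq_on)
open SupPolymerLocalGas (le_of_sets)
open SupActivityPolymerGas (act_measurable_prod)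

variable {ι : Type} [Fintype ι] [DecidableEq ι] {V : Type*} [DecidableEq V]

/-! ## §1. The shift: fine-cell small letter by Minkowski, stability by Young at the small rate -/

omit [Fintype ι] [DecidableEq ι] [DecidableEq V] in
/-- **THE FINE-CELL SHIFT.**  On a big cell `P` with a finite family `fineP` of fine cells: (S_fine) `‖g(ζ)‖ ≤ ε` whenever `Σ_cζ² ≤ h²` for every
`c ∈ fineP`; (L) `‖g(ζ)‖ ≤ M₀e^{½κ₀Σ_Pζ²}` for all `ζ`; `0 ≤ ε, M₀, κ₀`, `0 < τ`; an external field with `Σ_cψ² ≤ Ψ²` on every fine cell, `0 ≤ Ψ ≤ h`,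
and `Σ_Pψ² ≤ Ψ_P²` ⟹ for EVERY `ω`:
`‖g(ω+ψ)‖ ≤ ε + 1{∃c∈fineP: (h−Ψ)² < Σ_cω²}·(M₀e^{½κ₀(1+τ⁻¹)Ψ_P²})·e^{½κ₀(1+τ)Σ_Pω²}`. [folklore] -/
theorem fineCell_shift (P : Finset ι) (fineP : Finset (Finset ι)) {g : EuclideanSpace ℝ ι → ℂ} {ε M₀ κ₀ τ h Ψ ΨP : ℝ} (hε : 0 ≤ ε)
    (hM₀ : 0 ≤ M₀) (hκ₀ : 0 ≤ κ₀) (hτ : 0 < τ)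
    (hS : ∀ ζ : EuclideanSpace ℝ ι, (∀ c ∈ fineP, ∑ x ∈ c, ζ x ^ 2 ≤ h ^ 2) → ‖g ζ‖ ≤ ε)
    (hL : ∀ ζ : EuclideanSpace ℝ ι, ‖g ζ‖ ≤ M₀ * exp (κ₀ * (∑ x ∈ P, ζ x ^ 2) / 2))
    (ψ : EuclideanSpace ℝ ι) (hΨ0 : 0 ≤ Ψ) (hΨh : Ψ ≤ h) (hψ : ∀ c ∈ fineP, ∑ x ∈ c, ψ x ^ 2 ≤ Ψ ^ 2)
    (hψP : ∑ x ∈ P, ψ x ^ 2 ≤ ΨP ^ 2) (ω : EuclideanSpace ℝ ι) [Decidable (∃ c ∈ fineP, (h - Ψ) ^ 2 < ∑ x ∈ c, ω x ^ 2)] :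
    ‖g (ω + ψ)‖ ≤ ε + (if ∃ c ∈ fineP, (h - Ψ) ^ 2 < ∑ x ∈ c, ω x ^ 2 then
      (M₀ * exp (κ₀ * (1 + τ⁻¹) * ΨP ^ 2 / 2)) * exp (κ₀ * (1 + τ) * (∑ x ∈ P, ω x ^ 2) / 2) else 0) := by
  by_cases hall : ∀ c ∈ fineP, ∑ x ∈ c, (ω + ψ) x ^ 2 ≤ h ^ 2
  · -- every fine cell small: letter (S_fine)
    have h1 := hS _ hall
    have h2 : 0 ≤ (if ∃ c ∈ fineP, (h - Ψ) ^ 2 < ∑ x ∈ c, ω x ^ 2 then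
        (M₀ * exp (κ₀ * (1 + τ⁻¹) * ΨP ^ 2 / 2)) * exp (κ₀ * (1 + τ) * (∑ x ∈ P, ω x ^ 2) / 2) else 0) := by
      split_ifs <;> positivity
    linarith
  · -- some fine cell large after the shift ⟹ the fluctuation is large there (Minkowski); letter (L) + Young on the big cell at the small rate
    push Not at hall
    obtain ⟨c, hc, hlarge⟩ := hall
    have hω : (h - Ψ) ^ 2 < ∑ x ∈ c, ω x ^ 2 := large_of_shift_large c ω ψ hΨ0 hΨh (hψ c hc) hlarge
    have hex : ∃ c ∈ fineP, (h - Ψ) ^ 2 < ∑ x ∈ c, ω x ^ 2 := ⟨c, hc, hω⟩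
    rw [if_pos hex]
    have hsum : ∑ x ∈ P, (ω + ψ) x ^ 2 = ∑ x ∈ P, (ω x + ψ x) ^ 2 :=
      sum_congr rfl fun x _ => by simp only [WithLp.ofLp_add, Pi.add_apply]
    have hy := sum_add_sq_le P (fun x => ω x) (fun x => ψ x) hτ
    have hb : κ₀ * (∑ x ∈ P, (ω + ψ) x ^ 2) / 2 ≤ κ₀ * (1 + τ⁻¹) * ΨP ^ 2 / 2 + κ₀ * (1 + τ) * (∑ x ∈ P, ω x ^ 2) / 2 := by
      rw [hsum]
      have h1 := mul_le_mul_of_nonneg_left hy hκ₀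
      have h2 : 0 ≤ κ₀ * (1 + τ⁻¹) := by positivity
      have h3 := mul_le_mul_of_nonneg_left hψP h2
      nlinarith
    calc ‖g (ω + ψ)‖ ≤ M₀ * exp (κ₀ * (∑ x ∈ P, (ω + ψ) x ^ 2) / 2) := hL _
      _ ≤ M₀ * exp (κ₀ * (1 + τ⁻¹) * ΨP ^ 2 / 2 + κ₀ * (1 + τ) * (∑ x ∈ P, ω x ^ 2) / 2) :=
          mul_le_mul_of_nonneg_left (exp_le_exp.2 hb) hM₀
      _ = (M₀ * exp (κ₀ * (1 + τ⁻¹) * ΨP ^ 2 / 2)) * exp (κ₀ * (1 + τ) * (∑ x ∈ P, ω x ^ 2) / 2) := by rw [Real.exp_add]; ring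
      _ ≤ ε + (M₀ * exp (κ₀ * (1 + τ⁻¹) * ΨP ^ 2 / 2)) * exp (κ₀ * (1 + τ) * (∑ x ∈ P, ω x ^ 2) / 2) := by linarith

/-! ## §2. The set activity letter -/

omit [Fintype ι] [DecidableEq ι] [DecidableEq V] in
/-- `0 ≤ ε_fine`. [folklore] -/
theorem eps_fine_nonneg {ε M κ₂ r A : ℝ} {m : ℕ} (hε : 0 ≤ ε) (hM : 0 ≤ M) (hA : 0 ≤ A) :
    0 ≤ ε + m * M * exp (-(κ₂ * r ^ 2 / 2)) * A := by positivity

/-- **(379) FOR THE PRODUCT OF NORMS**: under the hypotheses of (379)'s `norm_cellActivity_le_fineCell`,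
`∫∏_{p∈K}‖g_p(ω)‖dN(0,Γ) ≤ ε_fine^{#K}` (apply (379) to the real nonnegative factors `‖g_p‖`). [folklore] -/
theorem integral_prod_norm_le_fineCell {Γ : Matrix ι ι ℝ} {γop γ₂ γ : ℝ} (hΓ : Γ.PosSemidef)
    (hΓop : (γop • (1 : Matrix ι ι ℝ) - Γ).PosSemidef) (hdiag : ∀ x, Γ x x ≤ γ) (hγ : 0 ≤ γ) (cell : V → Finset ι)
    (hdisj : ∀ p q, p ≠ q → Disjoint (cell p) (cell q)) {v : ℕ} (hv : ∀ p, (cell p).card ≤ v) (fine : V → Finset (Finset ι))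
    (hfine : ∀ p, ∀ c ∈ fine p, c ⊆ cell p) {v₀ : ℕ} (hv₀ : ∀ p, ∀ c ∈ fine p, c.card ≤ v₀) {m : ℕ} (hm : ∀ p, (fine p).card ≤ m)
    (hloc : ∀ (S : Finset V) (f : ∀ p ∈ S, Finset ι), (∀ p (hp : p ∈ S), f p hp ∈ fine p) →
      (γ₂ • (1 : Matrix (S.attach.biUnion fun p => f p.1 p.2) (S.attach.biUnion fun p => f p.1 p.2) ℝ) -
        Γ.submatrix (fun e : (S.attach.biUnion fun p => f p.1 p.2) => (e : ι))
          (fun e : (S.attach.biUnion fun p => f p.1 p.2) => (e : ι))).PosSemidef)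
    {g : V → EuclideanSpace ℝ ι → ℂ} {ε M κ₁ κ₂ θ r : ℝ} (hε : 0 ≤ ε) (hM : 0 ≤ M) (hκ₁ : 0 ≤ κ₁) (hκ₂ : 0 ≤ κ₂) (hθ0 : 0 < θ)
    (hθ1 : θ < 1) (h1 : 2 * κ₁ * γop ≤ θ) (h2 : 2 * κ₂ * γ₂ ≤ θ)
    (hpt : ∀ p ω, ‖g p ω‖ ≤ ε + (if ∃ c ∈ fine p, r ^ 2 < ∑ x ∈ c, ω x ^ 2 then M * exp (κ₁ * (∑ x ∈ cell p, ω x ^ 2) / 2) else 0))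
    (K : Finset V) :
    ∫ ω, ∏ p ∈ K, ‖g p ω‖ ∂(multivariateGaussian (0 : EuclideanSpace ℝ ι) Γ) ≤
      (ε + m * M * exp (-(κ₂ * r ^ 2 / 2)) *
        (((1 - θ) ^ (-(2 * κ₁ * γ / (2 * θ)))) ^ v * ((1 - θ) ^ (-(2 * κ₂ * γ / (2 * θ)))) ^ v₀)) ^ K.card := by
  have h := norm_cellActivity_le_fineCell hΓ hΓop hdiag hγ cell hdisj hv fine hfine hv₀ hm hloc (g := fun p ω => ((‖g p ω‖ : ℝ) : ℂ))
    hε hM hκ₁ hκ₂ hθ0 hθ1 h1 h2 (fun p ω => by rw [Complex.norm_real, norm_norm]; exact hpt p ω) K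
  unfold cellActivity at h
  have hprod : ∀ ω : EuclideanSpace ℝ ι, ∏ p ∈ K, (((‖g p ω‖ : ℝ)) : ℂ) = (((∏ p ∈ K, ‖g p ω‖ : ℝ)) : ℂ) := fun ω => by push_cast; rfl
  simp_rw [hprod] at h
  rw [integral_complex_ofReal, Complex.norm_real, Real.norm_of_nonneg
    (integral_nonneg fun ω => prod_nonneg fun p _ => norm_nonneg _)] at h
  exact h

omit [Fintype ι] [DecidableEq ι] in
/-- **A family of singletons is the image of the set of its points under `p ↦ {p}`.** [folklore] -/
theorem singletonFamily_eq_image (𝒜₁ : Finset (Finset V)) (h1 : ∀ X ∈ 𝒜₁, X.card = 1) :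
    𝒜₁ = (𝒜₁.biUnion id).image fun p => ({p} : Finset V) := by
  ext X
  simp only [mem_image, mem_biUnion, id_eq]
  constructor
  · intro hX
    obtain ⟨a, rfl⟩ := card_eq_one.1 (h1 X hX)
    exact ⟨a, ⟨{a}, hX, mem_singleton_self a⟩, rfl⟩
  · rintro ⟨p, ⟨Y, hY, hpY⟩, rfl⟩
    obtain ⟨b, rfl⟩ := card_eq_one.1 (h1 Y hY)
    rw [mem_singleton] at hpY
    subst hpY
    exact hY

omit [Fintype ι] [DecidableEq ι] in
/-- … hence products over a family of singletons re-index by points: `∏_{X∈𝒜₁}F(X) = ∏_{p∈⋃𝒜₁}F({p})`. [folklore] -/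
theorem prod_singletonFamily_eq {β : Type*} [CommMonoid β] (𝒜₁ : Finset (Finset V)) (h1 : ∀ X ∈ 𝒜₁, X.card = 1) (F : Finset V → β) :
    ∏ X ∈ 𝒜₁, F X = ∏ p ∈ 𝒜₁.biUnion id, F {p} := by
  conv_lhs => rw [singletonFamily_eq_image 𝒜₁ h1]
  rw [prod_image fun p _ q _ hpq => singleton_injective hpq]

/-- **THE SET ACTIVITY LETTER IN THE FINE-CELL FORMAT.**  `Γ ⪰ 0`, `Γ ⪯ γ_op·1`, diagonal `≤ γ` (`γ ≥ 0`); disjoint big cells of `≤ v` sites with fine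
families (`⊆` their cell, `≤ v₀` sites, `≤ m` each); the local letter `γ₂` on sparse unions; `0 ≤ ε, M, κ₁, κ₂`, `0 < θ < 1`, `2κ₁γ_op ≤ θ`,
`2κ₂γ₂ ≤ θ`; set factors cell-measurable, the SINGLETONS `{p}` with the fine-cell pointwise bound (cells `cell p`, fine cells `fine p`), the other sets
sup-small `‖f_X‖ ≤ ε^{#X}` ⟹ for every family `𝒜`: `‖M(𝒜)‖ ≤ ∏_{X∈𝒜}ε_fine^{#X}`. [folklore] -/
theorem norm_setActivity_le_fineCell {Γ : Matrix ι ι ℝ} {γop γ₂ γ : ℝ} (hΓ : Γ.PosSemidef)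
    (hΓop : (γop • (1 : Matrix ι ι ℝ) - Γ).PosSemidef) (hdiag : ∀ x, Γ x x ≤ γ) (hγ : 0 ≤ γ) (cell : V → Finset ι)
    (hdisj : ∀ p q, p ≠ q → Disjoint (cell p) (cell q)) {v : ℕ} (hv : ∀ p, (cell p).card ≤ v) (fine : V → Finset (Finset ι))
    (hfine : ∀ p, ∀ c ∈ fine p, c ⊆ cell p) {v₀ : ℕ} (hv₀ : ∀ p, ∀ c ∈ fine p, c.card ≤ v₀) {m : ℕ} (hm : ∀ p, (fine p).card ≤ m)
    (hloc : ∀ (S : Finset V) (f : ∀ p ∈ S, Finset ι), (∀ p (hp : p ∈ S), f p hp ∈ fine p) →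
      (γ₂ • (1 : Matrix (S.attach.biUnion fun p => f p.1 p.2) (S.attach.biUnion fun p => f p.1 p.2) ℝ) -
        Γ.submatrix (fun e : (S.attach.biUnion fun p => f p.1 p.2) => (e : ι))
          (fun e : (S.attach.biUnion fun p => f p.1 p.2) => (e : ι))).PosSemidef)
    {f : Finset V → EuclideanSpace ℝ ι → ℂ} {ε M κ₁ κ₂ θ r : ℝ} (hε : 0 ≤ ε) (hM : 0 ≤ M) (hκ₁ : 0 ≤ κ₁) (hκ₂ : 0 ≤ κ₂)
    (hθ0 : 0 < θ) (hθ1 : θ < 1) (h1 : 2 * κ₁ * γop ≤ θ) (h2 : 2 * κ₂ * γ₂ ≤ θ)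
    (hmeas : ∀ X, Measurable[⨆ p ∈ X, MeasurableSpace.comap (fun (ω : EuclideanSpace ℝ ι) (x : cell p) => ω x) inferInstance] (f X))
    (hpt : ∀ X : Finset V, X.card = 1 → ∀ ω : EuclideanSpace ℝ ι, ‖f X ω‖ ≤
      ε + (if ∃ c ∈ X.biUnion fine, r ^ 2 < ∑ x ∈ c, ω x ^ 2 then M * exp (κ₁ * (∑ x ∈ X.biUnion cell, ω x ^ 2) / 2) else 0))
    (hsup : ∀ X : Finset V, X.card ≠ 1 → ∀ ω : EuclideanSpace ℝ ι, ‖f X ω‖ ≤ ε ^ X.card) (𝒜 : Finset (Finset V)) :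
    ‖cellActivity (multivariateGaussian (0 : EuclideanSpace ℝ ι) Γ) f 𝒜‖ ≤
      ∏ X ∈ 𝒜, (ε + m * M * exp (-(κ₂ * r ^ 2 / 2)) *
        (((1 - θ) ^ (-(2 * κ₁ * γ / (2 * θ)))) ^ v * ((1 - θ) ^ (-(2 * κ₂ * γ / (2 * θ)))) ^ v₀)) ^ X.card := by
  set μ := multivariateGaussian (0 : EuclideanSpace ℝ ι) Γ with hμ
  set εf : ℝ := ε + m * M * exp (-(κ₂ * r ^ 2 / 2)) *
    (((1 - θ) ^ (-(2 * κ₁ * γ / (2 * θ)))) ^ v * ((1 - θ) ^ (-(2 * κ₂ * γ / (2 * θ)))) ^ v₀) with hεf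
  set 𝒜₁ := 𝒜.filter fun X => X.card = 1 with h𝒜₁
  set 𝒜₂ := 𝒜.filter fun X => ¬ X.card = 1 with h𝒜₂
  set K := 𝒜₁.biUnion id with hK
  have hεf0 : 0 ≤ εf := eps_fine_nonneg hε hM (by positivity)
  have hεle : ε ≤ εf := le_add_of_nonneg_right (by positivity)
  have h1mem : ∀ X ∈ 𝒜₁, X.card = 1 := fun X hX => (mem_filter.1 hX).2
  -- the singleton factors indexed by their points obey (379)'s pointwise bound
  have hptK : ∀ p ω, ‖f {p} ω‖ ≤
      ε + (if ∃ c ∈ fine p, r ^ 2 < ∑ x ∈ c, ω x ^ 2 then M * exp (κ₁ * (∑ x ∈ cell p, ω x ^ 2) / 2) else 0) := by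
    intro p ω
    have h := hpt {p} (card_singleton p) ω
    simp only [singleton_biUnion] at h
    exact h
  have hnormK := integral_prod_norm_le_fineCell hΓ hΓop hdiag hγ cell hdisj hv fine hfine hv₀ hm hloc
    (g := fun p ω => f {p} ω) hε hM hκ₁ hκ₂ hθ0 hθ1 h1 h2 hptK K
  -- the same product is integrable: crude one-rate domination at the small rate ((289) with constant `ε + M`)
  have hregK : ∀ p (ω : EuclideanSpace ℝ ι), ‖f {p} ω‖ ≤ (ε + M) * exp (κ₁ * (∑ x ∈ cell p, ω x ^ 2) / 2) := by
    intro p ω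
    refine (hptK p ω).trans ?_
    have hE : 1 ≤ exp (κ₁ * (∑ x ∈ cell p, ω x ^ 2) / 2) := one_le_exp (by positivity)
    have hI : (if ∃ c ∈ fine p, r ^ 2 < ∑ x ∈ c, ω x ^ 2 then M * exp (κ₁ * (∑ x ∈ cell p, ω x ^ 2) / 2) else 0) ≤
        M * exp (κ₁ * (∑ x ∈ cell p, ω x ^ 2) / 2) := by
      split_ifs
      · exact le_rfl
      · positivity
    nlinarith
  have hmeasK : ∀ p, Measurable[MeasurableSpace.comap (fun (ω : EuclideanSpace ℝ ι) (x : cell p) => ω x) inferInstance] (f {p}) := by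
    intro p
    have h := hmeas {p}
    rwa [Finset.iSup_singleton] at h
  have hκθ : κ₁ * γop ≤ θ := by
    rcases le_or_gt 0 (κ₁ * γop) with h | h <;> linarith
  have hintg := SupRegulatedActivityBound.integrable_prod_of_regulated hΓ hΓop cell hdisj hκ₁ hθ1 hκθ hmeasK hregK K
  have hintK : Integrable (fun ω => ∏ p ∈ K, ‖f {p} ω‖) μ :=
    hintg.norm.congr (ae_of_all _ fun ω => norm_prod _ _)
  -- pointwise: `∏_{X∈𝒜}‖f_X‖ ≤ (∏_{𝒜₂}ε^{#X})·∏_{p∈K}‖f_{p}‖`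
  have hptw : ∀ ω, ‖∏ X ∈ 𝒜, f X ω‖ ≤ (∏ X ∈ 𝒜₂, ε ^ X.card) * ∏ p ∈ K, ‖f {p} ω‖ := by
    intro ω
    rw [← prod_filter_mul_prod_filter_not 𝒜 (fun X => X.card = 1), norm_mul, mul_comm]
    have hA1 : ‖∏ X ∈ 𝒜₁, f X ω‖ = ∏ p ∈ K, ‖f {p} ω‖ := by
      rw [norm_prod, prod_singletonFamily_eq 𝒜₁ h1mem (fun X => ‖f X ω‖)]
    have hA2 : ‖∏ X ∈ 𝒜₂, f X ω‖ ≤ ∏ X ∈ 𝒜₂, ε ^ X.card := by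
      rw [norm_prod]
      exact prod_le_prod (fun X _ => norm_nonneg _) fun X hX => hsup X (mem_filter.1 hX).2 ω
    rw [hA1]
    exact mul_le_mul_of_nonneg_right hA2 (prod_nonneg fun _ _ => norm_nonneg _)
  unfold cellActivity
  calc ‖∫ ω, ∏ X ∈ 𝒜, f X ω ∂μ‖ ≤ ∫ ω, ‖∏ X ∈ 𝒜, f X ω‖ ∂μ := norm_integral_le_integral_norm _
    _ ≤ ∫ ω, (∏ X ∈ 𝒜₂, ε ^ X.card) * ∏ p ∈ K, ‖f {p} ω‖ ∂μ :=
        integral_mono_of_nonneg (ae_of_all _ fun _ => norm_nonneg _) (hintK.const_mul _) (ae_of_all _ hptw)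
    _ = (∏ X ∈ 𝒜₂, ε ^ X.card) * ∫ ω, ∏ p ∈ K, ‖f {p} ω‖ ∂μ := integral_const_mul _ _
    _ ≤ (∏ X ∈ 𝒜₂, εf ^ X.card) * εf ^ K.card :=
        mul_le_mul (prod_le_prod (fun X _ => pow_nonneg hε _) fun X _ => pow_le_pow_left₀ hε hεle _) hnormK
          (integral_nonneg fun ω => prod_nonneg fun _ _ => norm_nonneg _) (prod_nonneg fun X _ => pow_nonneg hεf0 _)
    _ = ∏ X ∈ 𝒜, εf ^ X.card := by
        have hKcard : εf ^ K.card = ∏ X ∈ 𝒜₁, εf ^ X.card := by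
          rw [prod_singletonFamily_eq 𝒜₁ h1mem (fun X => εf ^ X.card)]
          simp only [card_singleton, pow_one, prod_const, hK]
        rw [hKcard, mul_comm, prod_filter_mul_prod_filter_not]

/-! ## §3. Integrability of the products -/

omit [Fintype ι] in
/-- **Pointwise domination at the small rate**: singletons with the fine-cell pointwise bound, the others sup-small, `0 ≤ ε, M, κ₁` ⟹
`‖∏_{X∈𝒜}f_X(ω)‖ ≤ (ε+M)^{Σ_{X∈𝒜}#X}·e^{½κ₁Σ_{x∈cells 𝒜₁}ω_x²}` ((351)'s `norm_prod_le_of_letters` with the base `ε + M`). [folklore] -/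
theorem norm_prod_le_oneRate_crude (cell : V → Finset ι) (hdisj : ∀ p q, p ≠ q → Disjoint (cell p) (cell q))
    (fine : V → Finset (Finset ι)) {f : Finset V → EuclideanSpace ℝ ι → ℂ} {ε M κ₁ r : ℝ} (hε : 0 ≤ ε) (hM : 0 ≤ M) (hκ₁ : 0 ≤ κ₁)
    (hpt : ∀ X : Finset V, X.card = 1 → ∀ ω : EuclideanSpace ℝ ι, ‖f X ω‖ ≤
      ε + (if ∃ c ∈ X.biUnion fine, r ^ 2 < ∑ x ∈ c, ω x ^ 2 then M * exp (κ₁ * (∑ x ∈ X.biUnion cell, ω x ^ 2) / 2) else 0))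
    (hsup : ∀ X : Finset V, X.card ≠ 1 → ∀ ω : EuclideanSpace ℝ ι, ‖f X ω‖ ≤ ε ^ X.card) (𝒜 : Finset (Finset V)) (ω : EuclideanSpace ℝ ι) :
    ‖∏ X ∈ 𝒜, f X ω‖ ≤ (ε + M) ^ (∑ X ∈ 𝒜, X.card) *
      exp (κ₁ * (∑ x ∈ ((𝒜.filter fun X => X.card = 1).biUnion id).biUnion cell, ω x ^ 2) / 2) := by
  have hsplit : 𝒜.filter (fun X => X.card = 1) ∪ 𝒜.filter (fun X => ¬ X.card = 1) = 𝒜 := filter_union_filter_not_eq _ 𝒜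
  have h12 : Disjoint (𝒜.filter (fun X => X.card = 1)) (𝒜.filter (fun X => ¬ X.card = 1)) := disjoint_filter_filter_not 𝒜 𝒜 _
  have hpw : ∀ X ∈ 𝒜.filter (fun X => X.card = 1), ∀ Y ∈ 𝒜.filter (fun X => X.card = 1), X ≠ Y → Disjoint X Y := by
    intro X hX Y hY hXY
    obtain ⟨a, rfl⟩ := card_eq_one.1 (mem_filter.1 hX).2
    obtain ⟨b, rfl⟩ := card_eq_one.1 (mem_filter.1 hY).2
    rw [disjoint_singleton_left, mem_singleton]
    exact fun hab => hXY (by rw [hab])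
  have hreg' : ∀ X ∈ 𝒜.filter (fun X => X.card = 1), ∀ ω : EuclideanSpace ℝ ι,
      ‖f X ω‖ ≤ (ε + M) ^ X.card * exp (κ₁ * (∑ x ∈ X.biUnion cell, ω x ^ 2) / 2) := by
    intro X hX ω
    have hX1 := (mem_filter.1 hX).2
    refine (hpt X hX1 ω).trans ?_
    rw [hX1, pow_one]
    have hE : 1 ≤ exp (κ₁ * (∑ x ∈ X.biUnion cell, ω x ^ 2) / 2) := one_le_exp (by positivity)
    have hI : (if ∃ c ∈ X.biUnion fine, r ^ 2 < ∑ x ∈ c, ω x ^ 2 then M * exp (κ₁ * (∑ x ∈ X.biUnion cell, ω x ^ 2) / 2) else 0) ≤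
        M * exp (κ₁ * (∑ x ∈ X.biUnion cell, ω x ^ 2) / 2) := by
      split_ifs
      · exact le_rfl
      · positivity
    nlinarith
  have hsup' : ∀ X ∈ 𝒜.filter (fun X => ¬ X.card = 1), ∀ ω : EuclideanSpace ℝ ι, ‖f X ω‖ ≤ (ε + M) ^ X.card := fun X hX ω =>
    (hsup X (mem_filter.1 hX).2 ω).trans (pow_le_pow_left₀ hε (by linarith) _)
  have h := SupPolymerLocalActivityBound.norm_prod_le_of_letters cell hdisj (by positivity : 0 ≤ ε + M) h12 hpw hreg' hsup' ω (κ := κ₁)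
  rwa [hsplit] at h

/-- **INTEGRABILITY OF THE PRODUCTS IN THE FINE-CELL FORMAT**: `Γ ⪰ 0`, `Γ ⪯ γ_op·1`; disjoint cells; factors join-measurable; singletons with the
fine-cell pointwise bound, the others sup-small; `0 ≤ ε, M, κ₁`, `κ₁γ_op ≤ θ < 1` ⟹ every product `∏_{X∈𝒜}f_X` is integrable against `N(0,Γ)`.
[folklore] -/
theorem fineCell_integrable_prod {Γ : Matrix ι ι ℝ} {γop : ℝ} (hΓ : Γ.PosSemidef) (hΓop : (γop • (1 : Matrix ι ι ℝ) - Γ).PosSemidef)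
    (cell : V → Finset ι) (hdisj : ∀ p q, p ≠ q → Disjoint (cell p) (cell q)) (fine : V → Finset (Finset ι))
    {f : Finset V → EuclideanSpace ℝ ι → ℂ} {ε M κ₁ θ r : ℝ} (hε : 0 ≤ ε) (hM : 0 ≤ M) (hκ₁ : 0 ≤ κ₁) (hθ1 : θ < 1) (hκθ : κ₁ * γop ≤ θ)
    (hmeas : ∀ X, Measurable[⨆ p ∈ X, MeasurableSpace.comap (fun (ω : EuclideanSpace ℝ ι) (x : cell p) => ω x) inferInstance] (f X))
    (hpt : ∀ X : Finset V, X.card = 1 → ∀ ω : EuclideanSpace ℝ ι, ‖f X ω‖ ≤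
      ε + (if ∃ c ∈ X.biUnion fine, r ^ 2 < ∑ x ∈ c, ω x ^ 2 then M * exp (κ₁ * (∑ x ∈ X.biUnion cell, ω x ^ 2) / 2) else 0))
    (hsup : ∀ X : Finset V, X.card ≠ 1 → ∀ ω : EuclideanSpace ℝ ι, ‖f X ω‖ ≤ ε ^ X.card) (𝒜 : Finset (Finset V)) :
    Integrable (fun ω => ∏ X ∈ 𝒜, f X ω) (multivariateGaussian (0 : EuclideanSpace ℝ ι) Γ) := by
  have hle : ∀ p, MeasurableSpace.comap (fun (ω : EuclideanSpace ℝ ι) (x : cell p) => ω x) inferInstance ≤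
      (inferInstance : MeasurableSpace (EuclideanSpace ℝ ι)) := fun _ => measurable_iff_comap_le.1 (by fun_prop)
  have hmeasprod : Measurable fun ω => ∏ X ∈ 𝒜, f X ω :=
    act_measurable_prod (𝓕 := fun X : Finset V => ⨆ p ∈ X, MeasurableSpace.comap (fun (ω : EuclideanSpace ℝ ι) (x : cell p) => ω x)
      inferInstance) (fun X => le_of_sets hle X) hmeas 𝒜
  exact Integrable.mono' ((integrable_exp_half_sq_on hΓ hΓop hκ₁ hθ1 hκθ _).const_mul _) hmeasprod.aestronglyMeasurable
    (ae_of_all _ fun ω => norm_prod_le_oneRate_crude cell hdisj fine hε hM hκ₁ hpt hsup 𝒜 ω)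

/-! ## §4. Toy -/

omit [Fintype ι] [DecidableEq ι] in
/-- Toy (§2): the empty family of singletons re-indexes to the empty product. -/
example (F : Finset V → ℝ) : ∏ X ∈ (∅ : Finset (Finset V)), F X = ∏ p ∈ (∅ : Finset (Finset V)).biUnion id, F {p} :=
  prod_singletonFamily_eq ∅ (fun _ h => absurd h (Finset.notMem_empty _)) F

end Summit.QuantumFields.BalabanUV.T4Continuum.NE7b.SupFineCellSetActivity
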